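import Summits.QuantumFields.YangMills.Theorems.LuscherReductionRunningReductionKTRitzDiag
import HarnessLib

/-!
# Crux RED `RunningReduction`, line «KT»: the registered stub `stub_katoTempleDoor` (Kato–Temple–Lehmann quadratic residual bound for a
# separated Ritz cluster of the PSD transfer operator, fixed lattice)

Support module for crux `RunningReduction` (route `LuscherReduction`, item stmt-QuantumFields-19978), line «KT» (owner ym-beyond-p1 g16,
`Lines-KT.lean` abb17db2d52c586d): **`katoTempleDoor`** is the text of the registered stub `Stmt.stub_katoTempleDoor = KatoTempleDoor` VERBATIM,
stated over the tree constants `qform2`∕`ritzValue` of `…KTDefs` (the skeleton's local copies are character-identical; once the skeleton imports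
the Theorems defs the stub closes by `exact katoTempleDoor`).  Fleet service by seat ym-infvol-p2.

THE PROOF = instantiation of the tree's operator-free cluster Kato–Temple bound (lit g8, `ClusterKatoTempleBound.lean`:
`clusterKatoTemple_of_forall_gt`, `residualGram_le_of_variance`, `exists_orthonormal_formDiagonal_antitone`) with `D = physSubmodule L`,
`ip = l2Form L`, `K = transferOp β` (`…KTPhysSpace`), plus: the Gram matrix of an `l2`-definite linearly independent family is positive
definite; the Ritz values of the line are the sorted Rayleigh–Ritz eigenvalues (`ritzValue_eq_ritzDiag`, `…KTRitzDiag`); the min–max a-priori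
bound `levelValue (k+1) ≤ θ` in infimum form; `levelValue_le_of_forall_rayleigh_le` with the constraints `u₀ … u_{j−1}`.  A linearly dependent
family is excluded by the hypotheses (`ritzValue β φ k = 0 ≤ levelValue (k+1) ≤ θ < ritzValue β φ k`).

HONEST FRAMING: femto-universe rung R2b1, fixed-lattice functional analysis only; the line's weight is in its two XL stubs; nothing here
bears on infinite volume or the Clay gap.  References: T. Kato, J. Phys. Soc. Japan 4 (1949); N. J. Lehmann, Numer. Math. 5 (1963);
M. Reed, B. Simon IV (1978) Thm XIII.5.
-/

set_option autoImplicit false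

noncomputable section

open MeasureTheory Filter Topology Real
open Literature.MathematicalPhysics.QuantumFieldTheory
open Literature.MathematicalPhysics.QuantumLattice
open Literature.Analysis.OperatorTheory.YMMatrixModel
open Literature.Analysis.OperatorTheory Literature.Analysis.OperatorTheory.ClusterKatoTemple

namespace Summit.QuantumFields.YangMills.Theorems.FemtoTransferGap

variable {L : ℕ} [NeZero L]

/-! ### §1. Auxiliary facts -/

/-- `⟨ψ, K_β ψ⟩² ≤ ‖ψ‖² · qform2 ψ ψ` (Cauchy–Schwarz), hence the variance `qform2·l2 − qform²` is non-negative. [folklore] -/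
theorem qform_sq_le_qform2_mul_l2 (β : ℝ) {ψ : GaugeConfig 3 L SU2 → ℝ} (hψ : IsPhys ψ) :
    qform su2Rep β ψ ψ ^ 2 ≤ qform2 β ψ ψ * l2 ψ ψ := by
  rw [qform_eq_l2_transferApply]
  have h := sq_l2_le hψ (isPhys_transferApply β hψ)
  rw [mul_comm]
  exact h

/-- If `‖ψ‖² = 0` then `⟨ψ, K_β ψ⟩ = 0` (physical `ψ`). [folklore] -/
theorem qform_eq_zero_of_l2_eq_zero (β : ℝ) {ψ : GaugeConfig 3 L SU2 → ℝ} (hψ : IsPhys ψ) (h0 : l2 ψ ψ = 0) :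
    qform su2Rep β ψ ψ = 0 := by
  have h := qform_sq_le_qform2_mul_l2 β hψ
  rw [h0, mul_zero] at h
  exact pow_eq_zero_iff (n := 2) (by norm_num) |>.mp (le_antisymm h (sq_nonneg _))

/-- **A linearly dependent family has `ritzValue … k ≤ 0`**: with a basis of the span (`≤ k` vectors) as constraints no span element of
positive norm survives. [folklore] -/
theorem ritzValue_nonpos_of_not_linearIndependent {β : ℝ} (hβ : 0 ≤ β) {k : ℕ} {φ : Fin (k + 1) → (GaugeConfig 3 L SU2 → ℝ)}
    (hφ : ∀ i, IsPhys (φ i)) (hdep : ¬ LinearIndependent ℝ φ) : ritzValue β φ k ≤ 0 := by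
  classical
  -- the span inside the physical subspace and a basis of it
  let v : Fin (k + 1) → physSubmodule L := fun i => ⟨φ i, hφ i⟩
  have hvφ : (fun i => (v i : GaugeConfig 3 L SU2 → ℝ)) = φ := rfl
  set V : Submodule ℝ (physSubmodule L) := Submodule.span ℝ (Set.range v) with hV
  haveI : FiniteDimensional ℝ V := FiniteDimensional.span_of_finite ℝ (Set.finite_range v)
  set d := Module.finrank ℝ V with hd
  -- `d ≤ k` since `φ` is dependent
  have hdk : d ≤ k := by
    have hle : d ≤ k + 1 := by
      have h := finrank_range_le_card (R := ℝ) v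
      rw [Fintype.card_fin] at h
      exact h
    have hne : d ≠ k + 1 := by
      intro h
      apply hdep
      have hvind : LinearIndependent ℝ v := by
        rw [linearIndependent_iff_card_eq_finrank_span, Fintype.card_fin]
        exact h.symm
      exact hvind.map' (physSubmodule L).subtype (Submodule.ker_subtype _)
    omega
  haveI : Module.Free ℝ V := Module.Free.of_divisionRing ℝ V
  let b := Module.finBasis ℝ V
  -- constraints: the basis vectors, padded with zeros
  let χ : Fin k → (GaugeConfig 3 L SU2 → ℝ) := fun i =>
    if h : i.val < d then (((b ⟨i.val, h⟩ : V) : physSubmodule L) : GaugeConfig 3 L SU2 → ℝ) else 0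
  have hχ : ∀ i, χ i ∈ Submodule.span ℝ (Set.range φ) := by
    intro i
    by_cases h : i.val < d
    · simp only [χ, dif_pos h]
      rw [← hvφ, ← coe_mem_span_iff]
      exact (b ⟨i.val, h⟩).2
    · simp only [χ, dif_neg h]
      exact Submodule.zero_mem _
  -- the constrained set is empty
  have hempty : {r | ∃ ψ ∈ Submodule.span ℝ (Set.range φ), (∀ i, l2 ψ (χ i) = 0) ∧ 0 < l2 ψ ψ ∧
      r = qform su2Rep β ψ ψ / l2 ψ ψ} = ∅ := by
    ext r
    simp only [Set.mem_setOf_eq, Set.mem_empty_iff_false, iff_false]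
    rintro ⟨ψ, hψ, horth, hpos, -⟩
    -- `ψ` as an element of `V`, expanded in the basis
    set x : physSubmodule L := ⟨ψ, isPhys_of_mem_span hφ hψ⟩ with hx
    have hxV : x ∈ V := by rw [hV, coe_mem_span_iff, hvφ]; exact hψ
    set xV : V := ⟨x, hxV⟩ with hxVdef
    have hrepr : (xV : physSubmodule L) = ∑ i, (b.repr xV i) • ((b i : V) : physSubmodule L) := by
      conv_lhs => rw [← b.sum_repr xV]
      simp only [Submodule.coe_sum, Submodule.coe_smul]
    have horth' : ∀ i : Fin d, l2Form L x ((b i : V) : physSubmodule L) = 0 := by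
      intro i
      have hi : i.val < k := lt_of_lt_of_le i.2 hdk
      have h := horth ⟨i.val, hi⟩
      simp only [χ, dif_pos i.2] at h
      rw [l2Form_apply]
      exact h
    have hzero : l2 ψ ψ = 0 := by
      have h : l2Form L x (xV : physSubmodule L) = 0 := by
        rw [hrepr, bilin_sum_smul_right]
        exact Finset.sum_eq_zero fun i _ => by rw [horth' i, mul_zero]
      rw [l2Form_apply] at h
      exact h
    exact hpos.ne' hzero
  -- hence `ritzValue ≤ sSup ∅ = 0`
  have hbdd : BddBelow {s | ∃ χ' : Fin k → (GaugeConfig 3 L SU2 → ℝ), (∀ i, χ' i ∈ Submodule.span ℝ (Set.range φ)) ∧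
      s = sSup {r | ∃ ψ ∈ Submodule.span ℝ (Set.range φ), (∀ i, l2 ψ (χ' i) = 0) ∧ 0 < l2 ψ ψ ∧
        r = qform su2Rep β ψ ψ / l2 ψ ψ}} := by
    refine ⟨0, ?_⟩
    rintro s ⟨χ', -, rfl⟩
    refine Real.sSup_nonneg ?_
    rintro r ⟨ψ, hψ, -, hpos, rfl⟩
    exact div_nonneg (qform_su2Rep_self_nonneg hβ (isPhys_of_mem_span hφ hψ)) hpos.le
  have h := csInf_le hbdd ⟨χ, hχ, rfl⟩
  rw [hempty, Real.sSup_empty] at h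
  exact h

/-! ### §2. The door -/

/-- **`KatoTempleDoor`** — VERBATIM the registered stub `Stmt.stub_katoTempleDoor` of line «KT» (crux `RunningReduction`), over the tree
constants `ritzValue`∕`qform2`: if the `(k+1)`-st min–max value lies below `θ`, the trial family's bottom Ritz value lies above `θ`, and the
two-step variance on the span is `≤ ϱ` per unit norm², then each of the top `k+1` min–max values exceeds its Ritz value by at most
`ϱ/(m_k − θ)`. [cite: Kato1949, Lemma 2, Thm 1] [cite: Lehmann1963] [cite: ReedSimonIV1978, XIII.5] -/
theorem katoTempleDoor :
    ∀ (L : ℕ) [NeZero L] (β : ℝ) (k : ℕ) (φ : Fin (k + 1) → (GaugeConfig 3 L SU2 → ℝ)) (θ ϱ : ℝ), 1 ≤ β →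
      (∀ i, IsPhys (φ i)) → (∀ ψ ∈ Submodule.span ℝ (Set.range φ), ψ ≠ 0 → 0 < l2 ψ ψ) →
      levelValue su2Rep L β (k + 1) ≤ θ → θ < ritzValue β φ k →
      (∀ ψ ∈ Submodule.span ℝ (Set.range φ), qform2 β ψ ψ * l2 ψ ψ - qform su2Rep β ψ ψ ^ 2 ≤ ϱ * l2 ψ ψ ^ 2) →
      ∀ j : ℕ, j ≤ k → levelValue su2Rep L β j ≤ ritzValue β φ j + ϱ / (ritzValue β φ k - θ) := by
  intro L _ β k φ θ ϱ hβ hφ hdef hlev hθ hvar j hj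
  classical
  have hβ0 : 0 ≤ β := zero_le_one.trans hβ
  have hθ0 : 0 ≤ θ := (levelValue_su2Rep_nonneg L hβ0 (k + 1)).trans hlev
  -- the family is linearly independent (else `ritzValue k ≤ 0 ≤ θ`)
  have hind : LinearIndependent ℝ φ := by
    by_contra hdep
    have h := ritzValue_nonpos_of_not_linearIndependent hβ0 hφ hdep
    linarith
  -- the data of the operator-free engine
  let v : Fin (k + 1) → physSubmodule L := fun i => ⟨φ i, hφ i⟩
  have hvφ : (fun i => (v i : GaugeConfig 3 L SU2 → ℝ)) = φ := rfl
  set ip := l2Form L with hip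
  set K := transferOp (L := L) β with hK
  set E : physSubmodule L →ₗ[ℝ] physSubmodule L →ₗ[ℝ] ℝ := ip.compl₂ K with hE
  have hE_apply : ∀ x y, E x y = ip x (K y) := fun x y => LinearMap.compl₂_apply _ _ _ _
  have hip_symm : ∀ x y, ip x y = ip y x := l2Form_symm
  have hip_nonneg : ∀ x, 0 ≤ ip x x := l2Form_self_nonneg
  have hKsymm : ∀ x y, ip (K x) y = ip x (K y) := transferOp_symm β
  have hE_symm : ∀ x y, E x y = E y x := fun x y => by
    rw [hE_apply, hE_apply, ← hKsymm, hip_symm]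
  -- the Gram matrix of `v` is positive definite
  have hG : (Matrix.of fun i l => ip (v i) (v l)).PosDef := by
    refine Matrix.posDef_iff_dotProduct_mulVec.mpr ⟨?_, fun x hx => ?_⟩
    · ext i l
      simp only [Matrix.conjTranspose_apply, Matrix.of_apply, star_trivial, hip_symm (v l) (v i)]
    · have hquad : dotProduct (star x) (Matrix.mulVec (Matrix.of fun i l => ip (v i) (v l)) x) =
          ip (∑ i, x i • v i) (∑ l, x l • v l) := by
        rw [bilin_sum_smul_sum_smul, star_trivial, dotProduct]
        refine Finset.sum_congr rfl fun i _ => ?_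
        rw [Matrix.mulVec, dotProduct, Finset.mul_sum]
        refine Finset.sum_congr rfl fun l _ => ?_
        simp only [Matrix.of_apply]
        ring
      rw [hquad, hip, l2Form_apply]
      have hmem : ((∑ i, x i • v i : physSubmodule L) : GaugeConfig 3 L SU2 → ℝ) ∈ Submodule.span ℝ (Set.range φ) := by
        rw [Submodule.coe_sum]
        refine Submodule.sum_mem _ fun i _ => ?_
        rw [Submodule.coe_smul]
        exact Submodule.smul_mem _ _ (Submodule.subset_span ⟨i, rfl⟩)
      have hne : ((∑ i, x i • v i : physSubmodule L) : GaugeConfig 3 L SU2 → ℝ) ≠ 0 := by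
        intro h0
        apply hx
        have h1 : ∑ i, x i • φ i = 0 := by
          rw [← h0, Submodule.coe_sum]
          exact Finset.sum_congr rfl fun i _ => by rw [Submodule.coe_smul]
        exact funext fun i => (Fintype.linearIndependent_iff.mp hind x h1) i
      exact hdef _ hmem hne
  -- Rayleigh–Ritz diagonalisation inside the span, sorted
  obtain ⟨u, m, hanti, hu', hon', hdiag'⟩ := exists_orthonormal_formDiagonal_antitone ip E hE_symm v hG
  have hu : ∀ i, (u i : GaugeConfig 3 L SU2 → ℝ) ∈ Submodule.span ℝ (Set.range φ) := fun i => by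
    rw [← hvφ, ← coe_mem_span_iff]; exact hu' i
  have hon : ∀ i l, l2 (u i : GaugeConfig 3 L SU2 → ℝ) (u l) = if i = l then 1 else 0 := fun i l => by
    rw [← l2Form_apply]; exact hon' i l
  have hdiag : ∀ i l, qform su2Rep β (u i : GaugeConfig 3 L SU2 → ℝ) (u l) = if i = l then m i else 0 := fun i l => by
    rw [← l2Form_transferOp_right, ← hE_apply]; exact hdiag' i l
  have hspan := span_coe_eq_span φ u hu hon
  -- the Ritz values of the line ARE the sorted Ritz data
  set jF : Fin (k + 1) := ⟨j, Nat.lt_succ_of_le hj⟩ with hjF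
  set kF : Fin (k + 1) := ⟨k, Nat.lt_succ_of_le le_rfl⟩ with hkF
  have hRj : ritzValue β φ j = m jF := ritzValue_eq_ritzDiag hβ0 hφ hu hon hdiag hanti hj
  have hRk : ritzValue β φ k = m kF := ritzValue_eq_ritzDiag hβ0 hφ hu hon hdiag hanti le_rfl
  have hθlo : θ < m kF := by rw [← hRk]; exact hθ
  have hlohi : m kF ≤ m jF := hanti (show jF ≤ kF from hj)
  have hmlo : ∀ i : Fin (k + 1), m kF ≤ m i := fun i => hanti (show i ≤ kF from Nat.le_of_lt_succ i.2)
  have hmhi : ∀ i : Fin (k + 1), j ≤ i.val → m i ≤ m jF := fun i hi => hanti (show jF ≤ i from hi)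
  -- `ϱ ≥ 0` (the variance of `u 0` is non-negative and `‖u 0‖² = 1`)
  have hϱ : 0 ≤ ϱ := by
    have h1 := hvar _ (hu kF)
    have h2 := qform_sq_le_qform2_mul_l2 β (isPhys_coe (u kF))
    have hn : l2 (u kF : GaugeConfig 3 L SU2 → ℝ) (u kF) = 1 := by rw [hon, if_pos rfl]
    rw [hn] at h1 h2
    nlinarith
  -- residuals and the residual Gram bound from the variance clause
  set r : Fin (k + 1) → physSubmodule L := fun i => K (u i) - m i • u i with hr
  have hrepr : ∀ i y, E (u i) y = m i * ip (u i) y + ip (r i) y := by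
    intro i y
    rw [hE_apply, ← hKsymm, hr]
    simp only [map_sub, map_smul, LinearMap.sub_apply, LinearMap.smul_apply, smul_eq_mul]
    ring
  have hru : ∀ i l, ip (r i) (u l) = 0 := by
    intro i l
    rw [hr]
    simp only [map_sub, map_smul, LinearMap.sub_apply, LinearMap.smul_apply, smul_eq_mul]
    rw [hKsymm, ← hE_apply, hdiag', hon']
    split_ifs <;> ring
  have hvar' : ∀ s ∈ Submodule.span ℝ (Set.range u), ip (K s) (K s) * ip s s - ip s (K s) ^ 2 ≤ ϱ * ip s s ^ 2 := by
    intro s hs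
    rw [hip, hK, variance_dictionary, l2Form_apply]
    have hsφ : (s : GaugeConfig 3 L SU2 → ℝ) ∈ Submodule.span ℝ (Set.range φ) := by
      rw [← hspan, ← coe_mem_span_iff]; exact hs
    exact hvar _ hsφ
  have hres : ∀ c : Fin (k + 1) → ℝ, ∑ i, ∑ l, c i * c l * ip (r i) (r l) ≤ ϱ * ∑ i, c i ^ 2 := by
    intro c
    rw [← bilin_sum_smul_sum_smul]
    exact residualGram_le_of_variance ip hip_symm K hKsymm u m hon' (fun i l => by rw [← hE_apply]; exact hdiag' i l) hvar' c
  -- the a-priori bound in infimum form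
  have hθ' : ∀ θ', θ < θ' → ∃ χ : Fin (k + 1) → physSubmodule L, ∀ y, (∀ l, ip (χ l) y = 0) → E y y ≤ θ' * ip y y := by
    intro θ' hθθ'
    have hlt : levelValue su2Rep L β (k + 1) < θ' := lt_of_le_of_lt hlev hθθ'
    unfold levelValue at hlt
    have hne : ({s | ∃ φs : Fin (k + 1) → (GaugeConfig 3 L SU2 → ℝ), (∀ i, IsPhys (φs i)) ∧
        s = sSup (rayleighSet su2Rep L β fun ψ => ∀ i, l2 ψ (φs i) = 0)} : Set ℝ).Nonempty :=
      ⟨_, fun _ _ => 1, fun _ => isPhys_const 1, rfl⟩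
    obtain ⟨s, ⟨φs, hφs, rfl⟩, hs⟩ := exists_lt_of_csInf_lt hne hlt
    refine ⟨fun l => ⟨φs l, hφs l⟩, fun y hy => ?_⟩
    rw [hE_apply, hip, hK, l2Form_transferOp_right, l2Form_apply]
    have hyphys := isPhys_coe y
    rcases (l2_self_nonneg (y : GaugeConfig 3 L SU2 → ℝ)).eq_or_lt with h0 | hpos
    · rw [← h0, mul_zero, qform_eq_zero_of_l2_eq_zero β hyphys h0.symm]
    · have horth : ∀ l, l2 (y : GaugeConfig 3 L SU2 → ℝ) (φs l) = 0 := fun l => by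
        rw [l2_comm]; have h := hy l; rwa [hip, l2Form_apply] at h
      have hmem : qform su2Rep β (y : GaugeConfig 3 L SU2 → ℝ) y / l2 (y : GaugeConfig 3 L SU2 → ℝ) y ∈
          rayleighSet su2Rep L β (fun ψ => ∀ i, l2 ψ (φs i) = 0) := ⟨y, hyphys, horth, hpos, rfl⟩
      have hle := (le_csSup (bddAbove_rayleighSet_su2Rep L β _) hmem).trans hs.le
      rwa [div_le_iff₀ hpos] at hle
  -- the cluster Kato–Temple bound, then the min–max door
  have hs0 : 0 ≤ m jF + ϱ / (m kF - θ) := by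
    have : 0 ≤ ϱ / (m kF - θ) := div_nonneg hϱ (by linarith)
    linarith
  have hbound : levelValue su2Rep L β j ≤ m jF + ϱ / (m kF - θ) := by
    refine levelValue_le_of_forall_rayleigh_le su2Rep β hs0
      (fun i : Fin j => (u ⟨i.val, by omega⟩ : GaugeConfig 3 L SU2 → ℝ)) (fun i => isPhys_coe _) ?_
    intro ψ hψ horth hpos
    set x : physSubmodule L := ⟨ψ, hψ⟩ with hx
    have hxorth : ∀ i : Fin (k + 1), i.val < j → ip (u i) x = 0 := by
      intro i hi
      rw [hip, l2Form_apply, l2_comm]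
      exact horth ⟨i.val, hi⟩
    have h := clusterKatoTemple_of_forall_gt ip E hip_symm hip_nonneg hE_symm hθ' u r m hon' hrepr hru hϱ hres
      hθlo hlohi hmlo hmhi x hxorth
    rw [hE_apply, hip, hK, l2Form_transferOp_right, l2Form_apply] at h
    exact h
  rw [hRj, hRk]
  exact hbound

end Summit.QuantumFields.YangMills.Theorems.FemtoTransferGap

end
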